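import Mathlib
import HarnessLib

/-!
# Route LiouvilleSarnak — support `AlignedTypeI` (stmt-ValiantsHypothesis-21040), line `characters_mod_2n`:
# from von Mangoldt-weighted sums to log-weighted prime sums (removing prime powers)

Glue towards the hypothesis (PCS) of `alignedTypeI_of_primeCharSums`: the printed input (Banks–Shparlinski 2019 Thm 2.2) bounds
`ψ(x, χ) = Σ_{n ≤ x} Λ(n) χ(n)`; the partial summation of `…BilinearSievePrimeSums.lean` wants `Σ_{p ≤ t} (log p) c(p)`.  Def-free,
for arbitrary `c : ℕ → ℂ` with `|c| ≤ 1`, via Mathlib's Chebyshev functions: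
* `norm_sum_vonMangoldt_sub_logWeighted_le` — `‖Σ_{n≤t} Λ(n)c(n) − Σ_{p≤t} (log p)c(p)‖ ≤ ψ(t) − θ(t) ≤ 2√t log t`;
* `norm_logWeighted_le` — the trivial bound `‖Σ_{p ≤ t} (log p) c(p)‖ ≤ θ(t) ≤ (log 4 + 4) t`.

HONEST FRAMING. Bookkeeping only; `AlignedTypeI` is NOT closed here; nothing bears on `VP ≠ VNP` (NOT proved).
-/

set_option linter.dupNamespace false

noncomputable section

namespace Summit.ValiantsHypothesis.ValiantsHypothesis.Theorems.LiouvilleSarnak.AlignedTypeI.CharactersModTwoN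

open Finset ArithmeticFunction
open scoped BigOperators Chebyshev

/-- The primes of `[0, t]` are the primes of `(0, t]`. [folklore] -/
theorem Iic_filter_prime_eq_Ioc_filter_prime (t : ℕ) :
    (Finset.Iic t).filter Nat.Prime = (Finset.Ioc 0 t).filter Nat.Prime := by
  ext p
  simp only [Finset.mem_filter, Finset.mem_Iic, Finset.mem_Ioc]
  constructor
  · rintro ⟨hp, hpp⟩
    exact ⟨⟨hpp.pos, hp⟩, hpp⟩
  · rintro ⟨⟨_, hp⟩, hpp⟩
    exact ⟨hp, hpp⟩

/-- **Removing prime powers.**  For `|c| ≤ 1` and `t ≥ 1`: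
`‖Σ_{n ≤ t} Λ(n) c(n) − Σ_{p ≤ t} (log p) c(p)‖ ≤ ψ(t) − θ(t) ≤ 2 √t log t`. [folklore] -/
theorem norm_sum_vonMangoldt_sub_logWeighted_le (c : ℕ → ℂ) (hc : ∀ n, ‖c n‖ ≤ 1) (t : ℕ) (ht : 1 ≤ t) :
    ‖∑ n ∈ Finset.Ioc 0 t, ((vonMangoldt n : ℝ) : ℂ) * c n -
        ∑ p ∈ (Finset.Iic t).filter Nat.Prime, (Real.log p : ℂ) * c p‖ ≤ 2 * Real.sqrt t * Real.log t := by
  classical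
  have htR : (1 : ℝ) ≤ t := by exact_mod_cast ht
  -- the difference is the sum of `Λ(n) c(n)` over the non-primes
  have hdiff : ∑ n ∈ Finset.Ioc 0 t, ((vonMangoldt n : ℝ) : ℂ) * c n -
      ∑ p ∈ (Finset.Iic t).filter Nat.Prime, (Real.log p : ℂ) * c p =
      ∑ n ∈ (Finset.Ioc 0 t).filter (fun n => ¬ n.Prime), ((vonMangoldt n : ℝ) : ℂ) * c n := by
    rw [Iic_filter_prime_eq_Ioc_filter_prime, Finset.sum_filter, Finset.sum_filter, ← Finset.sum_sub_distrib]
    refine Finset.sum_congr rfl fun n _ => ?_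
    split_ifs with h
    · rw [vonMangoldt_apply_prime h, sub_self]
    · rw [sub_zero]
  rw [hdiff]
  have hpt : ψ (t : ℝ) - θ (t : ℝ) = ∑ n ∈ (Finset.Ioc 0 t).filter (fun n => ¬ n.Prime), vonMangoldt n := by
    rw [Chebyshev.psi_sub_theta_eq_sum_not_prime, Nat.floor_natCast]
  calc ‖∑ n ∈ (Finset.Ioc 0 t).filter (fun n => ¬ n.Prime), ((vonMangoldt n : ℝ) : ℂ) * c n‖
      ≤ ∑ n ∈ (Finset.Ioc 0 t).filter (fun n => ¬ n.Prime), ‖((vonMangoldt n : ℝ) : ℂ) * c n‖ := norm_sum_le _ _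
    _ ≤ ∑ n ∈ (Finset.Ioc 0 t).filter (fun n => ¬ n.Prime), vonMangoldt n := by
        refine Finset.sum_le_sum fun n _ => ?_
        rw [norm_mul, Complex.norm_real, Real.norm_eq_abs, abs_of_nonneg vonMangoldt_nonneg]
        calc vonMangoldt n * ‖c n‖ ≤ vonMangoldt n * 1 := mul_le_mul_of_nonneg_left (hc n) vonMangoldt_nonneg
          _ = vonMangoldt n := mul_one _
    _ = ψ (t : ℝ) - θ (t : ℝ) := hpt.symm
    _ ≤ 2 * Real.sqrt t * Real.log t := Chebyshev.psi_sub_theta_le htR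

/-- **Trivial bound for log-weighted prime sums**: `‖Σ_{p ≤ t} (log p) c(p)‖ ≤ θ(t) ≤ (log 4 + 4) t` for `|c| ≤ 1`. [folklore] -/
theorem norm_logWeighted_le (c : ℕ → ℂ) (hc : ∀ n, ‖c n‖ ≤ 1) (t : ℕ) :
    ‖∑ p ∈ (Finset.Iic t).filter Nat.Prime, (Real.log p : ℂ) * c p‖ ≤ (Real.log 4 + 4) * t := by
  classical
  have htheta : θ (t : ℝ) = ∑ p ∈ (Finset.Iic t).filter Nat.Prime, Real.log p := by
    rw [Chebyshev.theta, Nat.floor_natCast, Iic_filter_prime_eq_Ioc_filter_prime]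
  calc ‖∑ p ∈ (Finset.Iic t).filter Nat.Prime, (Real.log p : ℂ) * c p‖
      ≤ ∑ p ∈ (Finset.Iic t).filter Nat.Prime, ‖(Real.log p : ℂ) * c p‖ := norm_sum_le _ _
    _ ≤ ∑ p ∈ (Finset.Iic t).filter Nat.Prime, Real.log p := by
        refine Finset.sum_le_sum fun p hp => ?_
        have hpp := (Finset.mem_filter.mp hp).2
        have hlog : 0 ≤ Real.log p := Real.log_nonneg (by exact_mod_cast hpp.one_lt.le)
        rw [norm_mul, Complex.norm_real, Real.norm_eq_abs, abs_of_nonneg hlog]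
        calc Real.log p * ‖c p‖ ≤ Real.log p * 1 := mul_le_mul_of_nonneg_left (hc p) hlog
          _ = Real.log p := mul_one _
    _ = θ (t : ℝ) := htheta.symm
    _ ≤ ψ (t : ℝ) := Chebyshev.theta_le_psi _
    _ ≤ (Real.log 4 + 4) * t := Chebyshev.psi_le_const_mul_self (Nat.cast_nonneg t)

end Summit.ValiantsHypothesis.ValiantsHypothesis.Theorems.LiouvilleSarnak.AlignedTypeI.CharactersModTwoN
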